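import Literature.NumberTheory.Sieve.HeathBrownCubicLemma51
import HarnessLib

/-!
# Heath-Brown–Moroz 2004, §2: the congruence count on a SHIFTED line in a rectangle ((2.10); [3, (5.2)])

First brick of the class Type-I estimate (HBM04 Lemmas 2.2–2.3 = [HeathBrownActa2001, Lemma 5.1 / 3.2] for the
class family `CubicSieve.classPairs`): in the quotient coordinates `x = a + dx'`, `y = b + dy'` of an admissible
class, the divisibility `R ∣ x + y·2^{1/3}` (`N(R)` square-free, `2^{1/3} ≡ n (mod R)`, `(N(R), d) = 1`) reads
`N(R) ∣ x' + n y' + s` for a SHIFT `s` (`s ≡ d⁻¹(a + nb)`), and the ranges of `x'`, `y'` are two intervals of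
equal length up to `±1` — a rectangle rather than Heath-Brown's square.  This pure-proof file generalises the
tree's additive-character count of [3, (5.2)] (`card_filter_dvd_eq_sum`, `abs_card_filter_dvd_sub_le` of
`HeathBrownCubicLemma51`) to a rectangle `B₁ × B₂` and a shifted line; the shift only contributes the phase
`e(hs/N)` of modulus one, so the error term is literally Heath-Brown's:

* `card_filter_dvd_shift_eq_sum` — `#{(x,y) ∈ B₁×B₂ : N ∣ x + ny + s} = N⁻¹∑_{h<N} e(hs/N) F₁(h) G₂(h)`;
* `abs_card_filter_dvd_shift_sub_le` — `|#{…} − #B₁#B₂/N| ≤ N⁻¹ ∑_{0<h<N} |F₁(h)|·|G₂(h)|`;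
* `dvd_affine_iff_dvd_shift` — `N ∣ (a + dx') + n(b + dy') ↔ N ∣ x' + ny' + d̄(a + nb)` for `d d̄ ≡ 1 (mod N)`.

## References

* D. R. Heath-Brown, B. Z. Moroz, Proc. LMS (3) 88 (2004), §2 (2.10), Lemma 2.2. [cite: HeathBrownMoroz2004, Lemma 2.2]
* D. R. Heath-Brown, Acta Math. 186 (2001), §5 (5.2). [cite: HeathBrownActa2001, §5 (5.2)]

## Mathlib / tree search

Tree: `LargeSieve.e`, `e_add`, `e_add_int`, `e_zero`, `sum_range_e_mul_div_eq_ite_dvd` (`HeathBrownCubicLemma51`).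
`lean search 'dvd_shift_eq_sum|card_filter_dvd_shift'`: no hits.
-/

noncomputable section

open Finset

namespace Literature.NumberTheory.Sieve.CubicSieve

open Literature.NumberTheory.Sieve.LargeSieve

/-- **The count on the shifted line `x + ny + s ≡ 0 (mod N)` by additive characters**, for a rectangle
`B₁ × B₂` of natural numbers: `#{(x, y) ∈ B₁ × B₂ : N ∣ x + ny + s} = N⁻¹ ∑_{h<N} e(hs/N)(∑_{x∈B₁} e(hx/N))(∑_{y∈B₂} e(hny/N))`.
[cite: HeathBrownMoroz2004, Lemma 2.2] -/
theorem card_filter_dvd_shift_eq_sum {N : ℕ} (hN : 0 < N) (n s : ℤ) (B₁ B₂ : Finset ℕ) :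
    ((#{xy ∈ B₁ ×ˢ B₂ | (N : ℤ) ∣ (xy.1 : ℤ) + (xy.2 : ℤ) * n + s} : ℕ) : ℂ) =
      (N : ℂ)⁻¹ * ∑ h ∈ range N, e ((h : ℝ) * s / N) *
        ((∑ x ∈ B₁, e ((h : ℝ) * x / N)) * (∑ y ∈ B₂, e ((h : ℝ) * (n * y) / N))) := by
  have hNC : (N : ℂ) ≠ 0 := by exact_mod_cast hN.ne'
  have hind : ∀ xy ∈ B₁ ×ˢ B₂, (if (N : ℤ) ∣ (xy.1 : ℤ) + (xy.2 : ℤ) * n + s then (1 : ℂ) else 0) =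
      (N : ℂ)⁻¹ * ∑ h ∈ range N, e ((h : ℝ) * (((xy.1 : ℤ) + (xy.2 : ℤ) * n + s : ℤ) : ℝ) / N) := by
    intro xy _
    rw [sum_range_e_mul_div_eq_ite_dvd hN, eq_inv_mul_iff_mul_eq₀ hNC]
    split_ifs <;> simp
  rw [← sum_boole, sum_congr rfl hind, ← mul_sum, sum_comm]
  congr 1
  refine sum_congr rfl fun h _ => ?_
  rw [sum_product, sum_mul_sum, mul_sum]
  refine sum_congr rfl fun x _ => ?_
  rw [mul_sum]
  refine sum_congr rfl fun y _ => ?_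
  rw [← e_add, ← e_add]
  congr 1
  push_cast
  ring

/-- **The error of the shifted line count in a rectangle**: for `N ≥ 1`,
`|#{(x,y) ∈ B₁×B₂ : N ∣ x + ny + s} − #B₁·#B₂/N| ≤ N⁻¹ ∑_{0<h<N} |∑_{x∈B₁} e(hx/N)|·|∑_{y∈B₂} e(hny/N)|` (the
term `h = 0` is the main term; the shift's phase has modulus one). [cite: HeathBrownActa2001, §5 (5.2)] -/
theorem abs_card_filter_dvd_shift_sub_le {N : ℕ} (hN : 0 < N) (n s : ℤ) (B₁ B₂ : Finset ℕ) :
    |((#{xy ∈ B₁ ×ˢ B₂ | (N : ℤ) ∣ (xy.1 : ℤ) + (xy.2 : ℤ) * n + s} : ℕ) : ℝ) - (#B₁ : ℝ) * #B₂ / N| ≤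
      (N : ℝ)⁻¹ * ∑ h ∈ Ico 1 N, ‖∑ x ∈ B₁, e ((h : ℝ) * x / N)‖ * ‖∑ y ∈ B₂, e ((h : ℝ) * (n * y) / N)‖ := by
  set F : ℕ → ℂ := fun h => ∑ x ∈ B₁, e ((h : ℝ) * x / N) with hF
  set G : ℕ → ℂ := fun h => ∑ y ∈ B₂, e ((h : ℝ) * (n * y) / N) with hG
  set P : ℕ → ℂ := fun h => e ((h : ℝ) * s / N) with hP
  have hNC : (N : ℂ) ≠ 0 := by exact_mod_cast hN.ne'
  have hcount := card_filter_dvd_shift_eq_sum hN n s B₁ B₂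
  have hsplit : ∑ h ∈ range N, P h * (F h * G h) = (#B₁ : ℂ) * #B₂ + ∑ h ∈ Ico 1 N, P h * (F h * G h) := by
    rw [Finset.range_eq_Ico, ← Finset.insert_Ico_add_one_left_eq_Ico hN, sum_insert (by simp)]
    congr 1
    simp [hF, hG, hP, e_zero]
  have h : ((((#{xy ∈ B₁ ×ˢ B₂ | (N : ℤ) ∣ (xy.1 : ℤ) + (xy.2 : ℤ) * n + s} : ℕ) : ℝ) -
      (#B₁ : ℝ) * #B₂ / N : ℝ) : ℂ) = (N : ℂ)⁻¹ * ∑ h ∈ Ico 1 N, P h * (F h * G h) := by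
    push_cast
    rw [hcount, hsplit, mul_add]
    field_simp
    ring
  rw [← Real.norm_eq_abs, ← Complex.norm_real, h, norm_mul, norm_inv, Complex.norm_natCast]
  refine mul_le_mul_of_nonneg_left ((norm_sum_le _ _).trans (le_of_eq ?_)) (by positivity)
  refine sum_congr rfl fun a _ => ?_
  rw [norm_mul, norm_mul, hP]
  simp only [norm_e, one_mul, hF, hG]

/-- **The class condition as a shift**: if `d·d̄ ≡ 1 (mod N)` then
`N ∣ (a + dx') + n(b + dy') ↔ N ∣ x' + ny' + d̄(a + nb)`. [cite: HeathBrownMoroz2004, §2 (2.10)] -/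
theorem dvd_affine_iff_dvd_shift {N d dinv : ℤ} (hd : N ∣ d * dinv - 1) (a b n x y : ℤ) :
    N ∣ (a + d * x) + (b + d * y) * n ↔ N ∣ x + y * n + dinv * (a + n * b) := by
  obtain ⟨k, hk⟩ := hd
  have hdd : d * dinv = 1 + N * k := by linarith
  have e1 : x + y * n + dinv * (a + n * b) = dinv * ((a + d * x) + (b + d * y) * n) - k * N * (x + y * n) := by
    linear_combination (-(x + y * n)) * hdd
  have e2 : (a + d * x) + (b + d * y) * n = d * (x + y * n + dinv * (a + n * b)) - k * N * (a + n * b) := by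
    linear_combination (-(a + n * b)) * hdd
  constructor
  · intro h
    rw [e1]
    exact (h.mul_left dinv).sub (Dvd.intro (k * (x + y * n)) (by ring))
  · intro h
    rw [e2]
    exact (h.mul_left d).sub (Dvd.intro (k * (a + n * b)) (by ring))

end Literature.NumberTheory.Sieve.CubicSieve

end
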